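import Literature.RingTheory.TightClosure.TightClosure
import Literature.RingTheory.TightClosure.FRationalNormal
import Literature.RingTheory.IntegralClosure.KrullIntersection
import Mathlib.RingTheory.RegularLocalRing.Defs
import Mathlib.RingTheory.DedekindDomain.Basic
import Mathlib.RingTheory.KrullDimension.Basic
import Mathlib.Algebra.CharP.Algebra
import HarnessLib

/-!
# An isolated defect inside a non-isolated singular locus has dimension at least three
(crux `FrobeniusLadder.FRationalModification`, stmt-ResolutionOfSingularities-15316, line
`socle-discrepancy-certificate`, wave 3, registered sub-goal
`three_le_ringKrullDim_of_isolatedDefectInSingularLocus`)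

The line works at *isolated-defect germs*: Noetherian local domains `R` of prime characteristic `p` which
are rung 2 (Cohen–Macaulay with Frobenius-closed parameter ideals) but whose every PROPER localization
`R_q` (`q ≠ 𝔪` prime) is rung 3, i.e. a domain in which every ideal generated by a system of parameters is
tightly closed (F-rational, in the route's inline form `isFRational_iff_of_isDomain`). Its open stub
`stub_isolatedDefectInSingularLocus` treats the germs whose singular locus is NOT the closed point alone
(`hsing`: some `R_q`, `q ≠ 𝔪`, is not a regular local ring). This file records that such germs only exist
from dimension three on, so that the stub is VACUOUS in dimension `≤ 2`:

* `isRegularLocalRing_localization_of_fRational_clause_of_height_le_one` — the dimension-free support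
  lemma: if `q` is a prime of height `≤ 1` of a Noetherian domain of characteristic `p` and `R_q` satisfies
  the rung-3 clause, then `R_q` is regular. Indeed `R_q` is F-rational, hence NORMAL (Hochster–Huneke,
  Thm. 4.2 (b): `isIntegrallyClosed_of_fRational_clause`), of dimension `ht q ≤ 1`
  (`IsLocalization.AtPrime.ringKrullDim_eq_height`), and a normal Noetherian local domain of dimension
  `≤ 1` is a field or a discrete valuation ring (Matsumura, Thm. 11.2:
  `isRegularLocalRing_of_isIntegrallyClosed_of_ringKrullDim_le_one`). Equivalently: the singular-but-F-rational
  part of a punctured spectrum has codimension `≥ 2`.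
* `height_add_one_le_of_ne_maximalIdeal` — in a local ring, a non-maximal prime `q` has
  `ht q + 1 ≤ dim R`.
* `three_le_ringKrullDim_of_isolatedDefectInSingularLocus` — the registered form, verbatim: if
  `dim R ≤ 2`, every non-maximal prime has height `≤ 1`, so every `R_q` (`q ≠ 𝔪`) is regular by the
  support lemma, contradicting `hsing`; hence `3 ≤ dim R`. (The rung-2 hypothesis `h₂` is part of the
  registered signature but is not used.)

References: M. Hochster, C. Huneke, *F-regularity, test elements, and smooth base change*, Trans. AMS 346
(1994), Thm. 4.2 (b) [HochsterHuneke1994]; H. Matsumura, *Commutative Ring Theory* (1986), Thm. 11.2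
[Matsumura1987].
-/

-- single-problem summit: the doubled namespace component `ResolutionOfSingularities` is forced
set_option linter.dupNamespace false

noncomputable section

open IsLocalRing Literature.RingTheory.TightClosure Literature.RingTheory.IntegralClosure

namespace Summit.ResolutionOfSingularities.ResolutionOfSingularities.Theorems.FRationalModification.IsolatedDefectDimension

/-- **F-rational generizations of height `≤ 1` are regular.** Let `R` be a Noetherian domain of prime
characteristic `p` and `q` a prime of height `≤ 1` such that `R_q` satisfies the route's rung-3 clause
(every ideal of `R_q` generated by a system of parameters `s` satisfies
`c ≠ 0 ∧ (∀ e, c·y^(p^e) ∈ ((s))^[p^e]) ⇒ y ∈ (s)`). Then `R_q` is a regular local ring: it is F-rational,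
hence normal [HochsterHuneke1994, Thm. 4.2 (b)], of dimension `ht q ≤ 1`, hence a field or a DVR
[Matsumura1987, Thm. 11.2]. [cite: HochsterHuneke1994, Thm. 4.2 (b)] -/
theorem isRegularLocalRing_localization_of_fRational_clause_of_height_le_one (p : ℕ) [Fact p.Prime]
    {R : Type} [CommRing R] [IsNoetherianRing R] [IsDomain R] [CharP R p] (q : Ideal R) [q.IsPrime]
    (hq : q.height ≤ 1)
    (h : ∀ d : ℕ, ringKrullDim (Localization.AtPrime q) = d → ∀ s : Fin d → Localization.AtPrime q,
      (Ideal.span (Set.range s)).radical.IsMaximal → ∀ y c : Localization.AtPrime q, c ≠ 0 →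
        (∀ e : ℕ, c * y ^ p ^ e ∈ Ideal.span ((fun z : Localization.AtPrime q => z ^ p ^ e) ''
          (Ideal.span (Set.range s) : Set (Localization.AtPrime q)))) → y ∈ Ideal.span (Set.range s)) :
    IsRegularLocalRing (Localization.AtPrime q) := by
  have hinj : Function.Injective (algebraMap R (Localization.AtPrime q)) :=
    IsLocalization.injective (Localization.AtPrime q) q.primeCompl_le_nonZeroDivisors
  haveI : CharP (Localization.AtPrime q) p := charP_of_injective_algebraMap hinj p
  haveI : IsIntegrallyClosed (Localization.AtPrime q) := isIntegrallyClosed_of_fRational_clause p h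
  refine isRegularLocalRing_of_isIntegrallyClosed_of_ringKrullDim_le_one (Localization.AtPrime q) ?_
  rw [IsLocalization.AtPrime.ringKrullDim_eq_height q (Localization.AtPrime q)]
  exact_mod_cast hq

/-- In a local ring, a prime ideal `q` other than the maximal ideal satisfies `ht q + 1 ≤ dim R`
(`q < 𝔪` and `ht 𝔪 = dim R`). [folklore] -/
theorem height_add_one_le_of_ne_maximalIdeal {R : Type} [CommRing R] [IsLocalRing R] (q : Ideal R)
    [q.IsPrime] (hq : q ≠ maximalIdeal R) :
    ((q.height + 1 : ℕ∞) : WithBot ℕ∞) ≤ ringKrullDim R := by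
  have hlt : q < maximalIdeal R := lt_of_le_of_ne (IsLocalRing.le_maximalIdeal Ideal.IsPrime.ne_top') hq
  rw [← IsLocalRing.maximalIdeal_height_eq_ringKrullDim]
  exact_mod_cast Ideal.height_add_one_le_of_lt_of_isPrime hlt

/-- **`stub_isolatedDefectInSingularLocus` is vacuous in dimension `≤ 2`** (registered sub-goal
`three_le_ringKrullDim_of_isolatedDefectInSingularLocus` of line `socle-discrepancy-certificate`, verbatim).
For a Noetherian local domain `R` of characteristic `p` all of whose proper localizations `R_q` (`q ≠ 𝔪`
prime) satisfy the rung-3 clause (`hpunc`), if some such `R_q` is not regular (`hsing`) then `3 ≤ dim R`: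
otherwise `dim R ≤ 2`, every non-maximal prime has height `≤ 1`
(`height_add_one_le_of_ne_maximalIdeal`) and every `R_q` is regular
(`isRegularLocalRing_localization_of_fRational_clause_of_height_le_one`). The rung-2 hypothesis `h₂`
is part of the registered signature but is not used. [cite: HochsterHuneke1994, Thm. 4.2 (b)] -/
theorem three_le_ringKrullDim_of_isolatedDefectInSingularLocus
    (p : ℕ) [Fact p.Prime] (R : Type) [CommRing R] [IsNoetherianRing R] [IsLocalRing R] [IsDomain R] [CharP
    R p] (h₂ : IsDomain R ∧ ∀ d : ℕ, ringKrullDim R = d → ∀ s : Fin d → R, (Ideal.span (Set.range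
    s)).radical.IsMaximal → RingTheory.Sequence.IsWeaklyRegular R (List.ofFn s) ∧ ∀ y : R, (∃ e : ℕ, y ^ p ^
    e ∈ Ideal.span ((fun z : R => z ^ p ^ e) '' (Ideal.span (Set.range s) : Set R))) → y ∈ Ideal.span
    (Set.range s)) (hpunc : ∀ (q : Ideal R) [q.IsPrime], q ≠ IsLocalRing.maximalIdeal R → (IsDomain
    (Localization.AtPrime q) ∧ ∀ d : ℕ, ringKrullDim (Localization.AtPrime q) = d → ∀ s : Fin d →
    Localization.AtPrime q, (Ideal.span (Set.range s)).radical.IsMaximal → ∀ y c : Localization.AtPrime q, c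
    ≠ 0 → (∀ e : ℕ, c * y ^ p ^ e ∈ Ideal.span ((fun z : Localization.AtPrime q => z ^ p ^ e) '' (Ideal.span
    (Set.range s) : Set (Localization.AtPrime q)))) → y ∈ Ideal.span (Set.range s))) (hsing : ¬ (∀ (q :
    Ideal R) [q.IsPrime], q ≠ IsLocalRing.maximalIdeal R → IsRegularLocalRing (Localization.AtPrime q))) :
    (3 : WithBot ℕ∞) ≤ ringKrullDim R := by
  -- (`h₂`, rung 2 on `R`, is part of the registered signature but not needed)
  have _h₂ := h₂
  by_contra hlt
  refine hsing fun q _ hq => ?_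
  refine isRegularLocalRing_localization_of_fRational_clause_of_height_le_one p q ?_ (hpunc q hq).2
  -- `ht q + 1 ≤ dim R < 3`
  have hle := height_add_one_le_of_ne_maximalIdeal q hq
  obtain ⟨n, hn⟩ := exists_ringKrullDim_eq_nat (R := R)
  rw [hn] at hle hlt
  have hn3 : n < 3 := by
    by_contra h3
    exact hlt (by exact_mod_cast (not_lt.mp h3))
  have hle' : q.height + 1 ≤ (n : ℕ∞) := by exact_mod_cast hle
  have hfin : q.height ≠ ⊤ := by
    rintro htop
    rw [htop, top_add] at hle'
    exact (ENat.coe_ne_top n) (top_le_iff.mp hle')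
  lift q.height to ℕ using hfin with m hm
  have hm1 : m + 1 ≤ n := by exact_mod_cast hle'
  exact_mod_cast (show m ≤ 1 by omega)

end Summit.ResolutionOfSingularities.ResolutionOfSingularities.Theorems.FRationalModification.IsolatedDefectDimension

end
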